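import Literature.Analysis.FluidPDE.HardSphereUniqueness
import Summits.AtomisticToContinuum.HydrodynamicLimit.Theorems.MourreKoopmanChargesFluctuationFramework
import Summits.AtomisticToContinuum.HydrodynamicLimit.Theses.TwoClocks

/-!
# `EquilibriumShearWindowLD`: the flow quantifier is not load-bearing
# (route TwoClocks, stmt-AtomisticToContinuum-14446; forward uniqueness of hard-sphere flows)

Helper file (`--supports` stmt-AtomisticToContinuum-14446). The item
`TwoClocks.EquilibriumShearWindowLD` (and its parent crux `TwoClocks.EquilibriumFastWindowLD`,
stmt-14440) quantifies over ALL families `Φ` of hard-sphere flow structures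
(`HardSphereFlow`, a hypothesis structure: any a.e.-defined global flow whose good orbits are
hard-sphere trajectories). This quantifier is decorative:

* `hardSphereFlow_eq_of_mem_good` — two hard-sphere flows agree at all times `s ≥ 0` on their
  common good set (forward uniqueness of hard-sphere trajectories,
  `IsHardSphereTrajectory.unique_holds`, GST 2013 Prop. 4.1.1);
* `windowSum_congr_of_forward_eq`, `windowSum_ae_eq_of_flows` — hence every window functional
  `Σᵢ w⁻¹ ∫₀ʷ F(Φ_r z i) dr`, `w ≥ 0`, of two flows agrees almost surely under every local Gibbs
  law (local Gibbs laws are `≪` Liouville and charge no bad set);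
* `windowMoment_eq_of_flows` — the window exponential moments of two flows coincide (for every
  one-body observable `F`, every tilt, every window `w ≥ 0`, all profiles);
* flow families exist for `0 < σ < 1/2` (Alexander's theorem on `𝕋³`,
  `HardSphereFlow.nonempty_torus_holds`, since `0 < σ(N+1)^{-1/3} ≤ σ < 1/2`; reused from
  `FluctuationFramework.nonempty_flowFamily`);
* `equilibriumShearWindowLD_iff_exists_flow`, `equilibriumShearWindowLD_iff_fixed_flow` — **the
  item is equivalent to its version with `∀ Φ` replaced by `∃ Φ`, and to its instance along ANY
  fixed choice of flow families** (e.g. an explicit construction): a prover may fix one convenient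
  flow family, a refuter may attack any one;
* `equilibriumFastWindowLD_iff_exists_flow` — the same for the crux stmt-14440.

Nothing dynamical beyond forward uniqueness is used; the item (an open problem, the `u₀ = 0`,
`F = φ v⁰v¹` instance of stmt-14440) stays open.

References: I. Gallagher, L. Saint-Raymond, B. Texier, *From Newton to Boltzmann* (2013),
Prop. 4.1.1; R. K. Alexander, PhD thesis, Berkeley (1975).

prover-pitem-stmt-AtomisticToContinuum-14446-c4-0.
-/

noncomputable section

open MeasureTheory Real Set
open scoped ENNReal

namespace Summit.AtomisticToContinuum.HydrodynamicLimit.Theorems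

open Literature.Analysis.FluidPDE Literature.MathematicalPhysics.KineticTheory
open Summit.AtomisticToContinuum.HydrodynamicLimit.Theses.TwoClocks

/-! ### Forward agreement of two flows on the common good set -/

/-- **Two hard-sphere flows agree forward in time on their common good set** (both orbits are
hard-sphere trajectories issued from `z`, `flow_zero`; forward uniqueness
`IsHardSphereTrajectory.unique_holds`, GST 2013 Prop. 4.1.1; Hausdorff position space).
[folklore] -/
theorem hardSphereFlow_eq_of_mem_good {d : Type*} [Fintype d] {X : Type*} [MeasureSpace X]
    [TopologicalSpace X] [T2Space X] {G : Geometry d X} {ε : ℝ} {M : ℕ}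
    {Φ Ψ : HardSphereFlow G ε M} {z : Config M d X} (hΦ : z ∈ Φ.good) (hΨ : z ∈ Ψ.good)
    {s : ℝ} (hs : 0 ≤ s) : Φ.flow s z = Ψ.flow s z := by
  have h0 : Φ.flow 0 z = Ψ.flow 0 z := by rw [Φ.flow_zero z hΦ, Ψ.flow_zero z hΨ]
  exact IsHardSphereTrajectory.unique_holds (Φ.isTrajectory z hΦ) (Ψ.isTrajectory z hΨ) h0
    (Set.mem_Ici.2 hs)

/-- **The window functional only sees the forward orbit**: if two flows agree at `z` for all
`s ≥ 0`, their window functionals `Σᵢ w⁻¹ ∫₀ʷ F(Φ_r z i) dr` at `z` agree for every window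
`w ≥ 0` and every observable `F` (the interval integral over `[0, w]` only evaluates the orbit at
nonnegative times). [folklore] -/
theorem windowSum_congr_of_forward_eq {d : Type*} [Fintype d] {X : Type*} [MeasureSpace X]
    [TopologicalSpace X] {G : Geometry d X} {ε : ℝ} {M : ℕ}
    {Φ Ψ : HardSphereFlow G ε M} {z : Config M d X}
    (h : ∀ s, 0 ≤ s → Φ.flow s z = Ψ.flow s z) (F : X × EuclideanSpace ℝ d → ℝ) {w : ℝ}
    (hw : 0 ≤ w) :
    ∑ i, w⁻¹ * ∫ r in (0 : ℝ)..w, F (Φ.flow r z i) =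
      ∑ i, w⁻¹ * ∫ r in (0 : ℝ)..w, F (Ψ.flow r z i) := by
  refine Finset.sum_congr rfl fun i _ => ?_
  congr 1
  refine intervalIntegral.integral_congr fun r hr => ?_
  rw [Set.uIcc_of_le hw] at hr
  simp only [h r hr.1]

/-! ### Under a local Gibbs law the choice of the flow is immaterial -/

section Torus

variable {σ : ℝ} {N : ℕ}

/-- The local Gibbs law does not depend on its flow argument (the flow only fixes the phase
space). [folklore] -/
theorem localGibbsLaw_flow_irrel' (a₀ θ₀ : T3 → ℝ) (u₀ : T3 → V3)
    (Φ Ψ : HardSphereFlow (Torus.geometry (Fin 3)) (hsDiameter σ N) (N + 1)) :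
    localGibbsLaw σ a₀ u₀ θ₀ N Φ = localGibbsLaw σ a₀ u₀ θ₀ N Ψ := rfl

/-- A local Gibbs law (absolutely continuous with respect to the Liouville measure) charges no
bad set: almost every configuration is good for ANY hard-sphere flow. [folklore] -/
theorem ae_mem_good_localGibbsLaw' (a₀ θ₀ : T3 → ℝ) (u₀ : T3 → V3)
    (Φ Ψ : HardSphereFlow (Torus.geometry (Fin 3)) (hsDiameter σ N) (N + 1)) :
    ∀ᵐ z ∂(localGibbsLaw σ a₀ u₀ θ₀ N Φ), z ∈ Ψ.good := by
  have hL : localGibbsLaw σ a₀ u₀ θ₀ N Φ ≪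
      liouville (Torus.geometry (Fin 3)) (N + 1) (hsDiameter σ N) := by
    unfold localGibbsLaw
    rw [particleLaw_eq]
    exact withDensity_absolutelyContinuous _ _
  exact hL.ae_le Ψ.ae_mem_good

/-- **The window functionals of two flows agree almost surely** under every local Gibbs law, for
every observable `F` and every window `w ≥ 0`. [folklore] -/
theorem windowSum_ae_eq_of_flows (a₀ θ₀ : T3 → ℝ) (u₀ : T3 → V3)
    (Φ Ψ : HardSphereFlow (Torus.geometry (Fin 3)) (hsDiameter σ N) (N + 1))
    (F : T3 × V3 → ℝ) {w : ℝ} (hw : 0 ≤ w) :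
    (fun z => ∑ i, w⁻¹ * ∫ r in (0 : ℝ)..w, F (Φ.flow r z i)) =ᵐ[localGibbsLaw σ a₀ u₀ θ₀ N Φ]
      fun z => ∑ i, w⁻¹ * ∫ r in (0 : ℝ)..w, F (Ψ.flow r z i) := by
  filter_upwards [ae_mem_good_localGibbsLaw' a₀ θ₀ u₀ Φ Φ, ae_mem_good_localGibbsLaw' a₀ θ₀ u₀ Φ Ψ]
    with z hzΦ hzΨ
  exact windowSum_congr_of_forward_eq (fun s hs => hardSphereFlow_eq_of_mem_good hzΦ hzΨ hs) F hw

/-- **Window exponential moments do not depend on the choice of the flow**: for two hard-sphere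
flows `Φ, Ψ` of `N + 1` spheres of diameter `σ(N+1)^{-1/3}` on `𝕋³`, all profiles, every
observable `F`, tilt `β` and window `w ≥ 0`,
`∫ exp(β Σᵢ w⁻¹∫₀ʷ F(Φ_r z i) dr) dλ_Φ = ∫ exp(β Σᵢ w⁻¹∫₀ʷ F(Ψ_r z i) dr) dλ_Ψ`,
`λ_Φ = λ_Ψ` the local Gibbs law. [folklore] -/
theorem windowMoment_eq_of_flows (a₀ θ₀ : T3 → ℝ) (u₀ : T3 → V3)
    (Φ Ψ : HardSphereFlow (Torus.geometry (Fin 3)) (hsDiameter σ N) (N + 1))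
    (F : T3 × V3 → ℝ) (β : ℝ) {w : ℝ} (hw : 0 ≤ w) :
    ∫⁻ z, ENNReal.ofReal (Real.exp (β * ∑ i, w⁻¹ * ∫ r in (0 : ℝ)..w, F (Φ.flow r z i)))
        ∂(localGibbsLaw σ a₀ u₀ θ₀ N Φ) =
      ∫⁻ z, ENNReal.ofReal (Real.exp (β * ∑ i, w⁻¹ * ∫ r in (0 : ℝ)..w, F (Ψ.flow r z i)))
        ∂(localGibbsLaw σ a₀ u₀ θ₀ N Ψ) := by
  rw [← localGibbsLaw_flow_irrel' a₀ θ₀ u₀ Φ Ψ]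
  refine lintegral_congr_ae ?_
  filter_upwards [windowSum_ae_eq_of_flows a₀ θ₀ u₀ Φ Ψ F hw] with z hz
  rw [hz]

/-- The kinetic window `τ(N+1)^{-1/3}` is nonnegative for `τ ≥ 0`. [folklore] -/
theorem kineticWindow_nonneg {τ : ℝ} (hτ : 0 ≤ τ) (N : ℕ) :
    0 ≤ τ * ((N : ℝ) + 1) ^ (-(1 / 3 : ℝ)) :=
  mul_nonneg hτ (Real.rpow_nonneg (by positivity) _)

/-- **The item's window moment of the kinetic shear stress does not depend on the flow.**
[folklore] -/
theorem shearWindowMoment_eq_of_flows (a₀ θ₀ : ℝ)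
    (Φ Ψ : HardSphereFlow (Torus.geometry (Fin 3)) (hsDiameter σ N) (N + 1))
    (φ : T3 → ℝ) (β : ℝ) {τ : ℝ} (hτ : 0 ≤ τ) :
    ∫⁻ z, ENNReal.ofReal (Real.exp (β * ∑ i : Fin (N + 1),
        (τ * ((N : ℝ) + 1) ^ (-(1 / 3 : ℝ)))⁻¹ *
          ∫ r in (0 : ℝ)..(τ * ((N : ℝ) + 1) ^ (-(1 / 3 : ℝ))),
            φ (Φ.flow r z i).1 * ((Φ.flow r z i).2 0 * (Φ.flow r z i).2 1)))
        ∂(localGibbsLaw σ (fun _ => a₀) (fun _ => 0) (fun _ => θ₀) N Φ) =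
      ∫⁻ z, ENNReal.ofReal (Real.exp (β * ∑ i : Fin (N + 1),
        (τ * ((N : ℝ) + 1) ^ (-(1 / 3 : ℝ)))⁻¹ *
          ∫ r in (0 : ℝ)..(τ * ((N : ℝ) + 1) ^ (-(1 / 3 : ℝ))),
            φ (Ψ.flow r z i).1 * ((Ψ.flow r z i).2 0 * (Ψ.flow r z i).2 1)))
        ∂(localGibbsLaw σ (fun _ => a₀) (fun _ => 0) (fun _ => θ₀) N Ψ) :=
  windowMoment_eq_of_flows (fun _ => a₀) (fun _ => θ₀) (fun _ => 0) Φ Ψ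
    (fun y => φ y.1 * (y.2 0 * y.2 1)) β (kineticWindow_nonneg hτ N)

/-! ### The flow quantifier of the item is not load-bearing -/

/-- **`EquilibriumShearWindowLD` with `∀ Φ` is equivalent to `EquilibriumShearWindowLD` with
`∃ Φ`.** (`→`: flow families exist below `σ = 1/2`, so shrink `σ₀` to `min σ₀ (1/2)` and take any;
`←`: the window moment of the given family equals that of the provided one,
`shearWindowMoment_eq_of_flows`.) [folklore] -/
theorem equilibriumShearWindowLD_iff_exists_flow :
    EquilibriumShearWindowLD ↔
      ∃ σ₀ : ℝ, 0 < σ₀ ∧ ∀ (a₀ θ₀ : ℝ), 0 < a₀ → 0 < θ₀ → ∀ σ : ℝ, 0 < σ → σ < σ₀ →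
        ∃ Φ : (N : ℕ) → HardSphereFlow (Torus.geometry (Fin 3)) (hsDiameter σ N) (N + 1),
        ∀ φ : T3 → ℝ, Continuous φ → ∃ β₀ : ℝ, 0 < β₀ ∧ ∀ β : ℝ, |β| ≤ β₀ → ∀ ε : ℝ, 0 < ε →
          ∃ τ : ℝ, 0 < τ ∧ ∃ N₀ : ℕ, ∀ N : ℕ, N₀ ≤ N →
            ∫⁻ z, ENNReal.ofReal (Real.exp (β * ∑ i : Fin (N + 1),
                (τ * ((N : ℝ) + 1) ^ (-(1 / 3 : ℝ)))⁻¹ *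
                  ∫ r in (0 : ℝ)..(τ * ((N : ℝ) + 1) ^ (-(1 / 3 : ℝ))),
                    φ ((Φ N).flow r z i).1 * (((Φ N).flow r z i).2 0 * ((Φ N).flow r z i).2 1)))
                ∂(localGibbsLaw σ (fun _ => a₀) (fun _ => 0) (fun _ => θ₀) N (Φ N)) ≤
              ENNReal.ofReal (Real.exp (ε * ((N : ℝ) + 1))) := by
  constructor
  · rintro ⟨σ₀, hσ₀, h⟩
    refine ⟨min σ₀ (1 / 2), lt_min hσ₀ (by norm_num), fun a₀ θ₀ ha hθ σ hσ hσσ => ?_⟩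
    obtain ⟨Φ⟩ := FluctuationFramework.nonempty_flowFamily hσ (lt_of_lt_of_le hσσ (min_le_right _ _))
    exact ⟨Φ, h a₀ θ₀ ha hθ σ hσ (hσσ.trans_le (min_le_left _ _)) Φ⟩
  · rintro ⟨σ₀, hσ₀, h⟩
    refine ⟨σ₀, hσ₀, fun a₀ θ₀ ha hθ σ hσ hσσ Φ φ hφ => ?_⟩
    obtain ⟨Ψ, hΨ⟩ := h a₀ θ₀ ha hθ σ hσ hσσ
    obtain ⟨β₀, hβ₀, hβ⟩ := hΨ φ hφ
    refine ⟨β₀, hβ₀, fun β hb ε hε => ?_⟩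
    obtain ⟨τ, hτ, N₀, hN⟩ := hβ β hb ε hε
    refine ⟨τ, hτ, N₀, fun N hNN => ?_⟩
    rw [shearWindowMoment_eq_of_flows a₀ θ₀ (Φ N) (Ψ N) φ β hτ.le]
    exact hN N hNN

/-- **`EquilibriumShearWindowLD` is equivalent to its instance along ANY fixed choice of flow
families** `Φ₀ σ : (N : ℕ) → HardSphereFlow … (hsDiameter σ N) (N + 1)` (e.g. an explicit
construction of the dynamics): the `∀ Φ` of the item may be replaced by `Φ := Φ₀ σ`. [folklore] -/
theorem equilibriumShearWindowLD_iff_fixed_flow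
    (Φ₀ : (σ : ℝ) → (N : ℕ) → HardSphereFlow (Torus.geometry (Fin 3)) (hsDiameter σ N) (N + 1)) :
    EquilibriumShearWindowLD ↔
      ∃ σ₀ : ℝ, 0 < σ₀ ∧ ∀ (a₀ θ₀ : ℝ), 0 < a₀ → 0 < θ₀ → ∀ σ : ℝ, 0 < σ → σ < σ₀ →
        ∀ φ : T3 → ℝ, Continuous φ → ∃ β₀ : ℝ, 0 < β₀ ∧ ∀ β : ℝ, |β| ≤ β₀ → ∀ ε : ℝ, 0 < ε →
          ∃ τ : ℝ, 0 < τ ∧ ∃ N₀ : ℕ, ∀ N : ℕ, N₀ ≤ N →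
            ∫⁻ z, ENNReal.ofReal (Real.exp (β * ∑ i : Fin (N + 1),
                (τ * ((N : ℝ) + 1) ^ (-(1 / 3 : ℝ)))⁻¹ *
                  ∫ r in (0 : ℝ)..(τ * ((N : ℝ) + 1) ^ (-(1 / 3 : ℝ))),
                    φ ((Φ₀ σ N).flow r z i).1 *
                      (((Φ₀ σ N).flow r z i).2 0 * ((Φ₀ σ N).flow r z i).2 1)))
                ∂(localGibbsLaw σ (fun _ => a₀) (fun _ => 0) (fun _ => θ₀) N (Φ₀ σ N)) ≤
              ENNReal.ofReal (Real.exp (ε * ((N : ℝ) + 1))) := by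
  constructor
  · rintro ⟨σ₀, hσ₀, h⟩
    exact ⟨σ₀, hσ₀, fun a₀ θ₀ ha hθ σ hσ hσσ => h a₀ θ₀ ha hθ σ hσ hσσ (Φ₀ σ)⟩
  · rintro ⟨σ₀, hσ₀, h⟩
    exact equilibriumShearWindowLD_iff_exists_flow.2
      ⟨σ₀, hσ₀, fun a₀ θ₀ ha hθ σ hσ hσσ => ⟨Φ₀ σ, h a₀ θ₀ ha hθ σ hσ hσσ⟩⟩

/-- **The same for the parent crux `EquilibriumFastWindowLD`** (stmt-AtomisticToContinuum-14440):
its `∀ Φ` may be replaced by `∃ Φ` (`windowMoment_eq_of_flows` for a general observable `F`).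
[folklore] -/
theorem equilibriumFastWindowLD_iff_exists_flow :
    EquilibriumFastWindowLD ↔
      ∃ σ₀ : ℝ, 0 < σ₀ ∧ ∀ (a₀ θ₀ : ℝ) (u₀ : V3), 0 < a₀ → 0 < θ₀ → ∀ σ : ℝ, 0 < σ → σ < σ₀ →
        ∃ Φ : (N : ℕ) → HardSphereFlow (Torus.geometry (Fin 3)) (hsDiameter σ N) (N + 1),
        ∀ F : T3 × V3 → ℝ, Continuous F → (∃ C : ℝ, ∀ y, |F y| ≤ C * (1 + ‖y.2‖ ^ 2)) →
        (∀ x, ∫ v, F (x, v) * localMaxwellian 1 θ₀ u₀ v = 0) →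
        (∀ x (j : Fin 3), ∫ v, F (x, v) * v j * localMaxwellian 1 θ₀ u₀ v = 0) →
        (∀ x, ∫ v, F (x, v) * ‖v‖ ^ 2 * localMaxwellian 1 θ₀ u₀ v = 0) →
        ∃ β₀ : ℝ, 0 < β₀ ∧ ∀ β : ℝ, |β| ≤ β₀ → ∀ ε : ℝ, 0 < ε → ∃ τ : ℝ, 0 < τ ∧ ∃ N₀ : ℕ,
          ∀ N : ℕ, N₀ ≤ N →
            ∫⁻ z, ENNReal.ofReal (Real.exp (β * ∑ i : Fin (N + 1),
                (τ * ((N : ℝ) + 1) ^ (-(1 / 3 : ℝ)))⁻¹ *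
                  ∫ r in (0 : ℝ)..(τ * ((N : ℝ) + 1) ^ (-(1 / 3 : ℝ))), F (((Φ N).flow r z) i)))
                ∂(localGibbsLaw σ (fun _ => a₀) (fun _ => u₀) (fun _ => θ₀) N (Φ N)) ≤
              ENNReal.ofReal (Real.exp (ε * ((N : ℝ) + 1))) := by
  constructor
  · rintro ⟨σ₀, hσ₀, h⟩
    refine ⟨min σ₀ (1 / 2), lt_min hσ₀ (by norm_num), fun a₀ θ₀ u₀ ha hθ σ hσ hσσ => ?_⟩
    obtain ⟨Φ⟩ := FluctuationFramework.nonempty_flowFamily hσ (lt_of_lt_of_le hσσ (min_le_right _ _))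
    exact ⟨Φ, h a₀ θ₀ u₀ ha hθ σ hσ (hσσ.trans_le (min_le_left _ _)) Φ⟩
  · rintro ⟨σ₀, hσ₀, h⟩
    refine ⟨σ₀, hσ₀, fun a₀ θ₀ u₀ ha hθ σ hσ hσσ Φ F hF hC h1 hv hE => ?_⟩
    obtain ⟨Ψ, hΨ⟩ := h a₀ θ₀ u₀ ha hθ σ hσ hσσ
    obtain ⟨β₀, hβ₀, hβ⟩ := hΨ F hF hC h1 hv hE
    refine ⟨β₀, hβ₀, fun β hb ε hε => ?_⟩
    obtain ⟨τ, hτ, N₀, hN⟩ := hβ β hb ε hε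
    refine ⟨τ, hτ, N₀, fun N hNN => ?_⟩
    rw [windowMoment_eq_of_flows (fun _ => a₀) (fun _ => θ₀) (fun _ => u₀) (Φ N) (Ψ N) F β
      (kineticWindow_nonneg hτ.le N)]
    exact hN N hNN

end Torus

end Summit.AtomisticToContinuum.HydrodynamicLimit.Theorems

end
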